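import Literature.NumberTheory.EllipticCurves.KatoAdditiveTwistedValueNeronIntegralityTwo
import Literature.NumberTheory.EllipticCurves.KatoAdditiveTwistedValueNeronIntegralityTwoReal
import HarnessLib

/-!
# The real-period reading at `2` implies the polar reading — proved form

Topic `NumberTheory/EllipticCurves`. Theorem-only companion of
`KatoAdditiveTwistedValueNeronIntegralityTwoReal.lean`: the named fact
`kato_neron_isIntegral_twistedSymbolSum_of_additive_two_real` (conclusion `IsIntegral ℤ (s·ϖ·r)`, `s` odd) implies
its sibling `kato_neron_isIntegral_twistedSymbolSum_of_additive_two_polar`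
(`KatoAdditiveTwistedValueNeronIntegralityTwo.lean`; conclusion `IsIntegral ℤ (s·#π₀(V(ℝ))·ϖ·r)`), because the
deleted factor `#π₀(V(ℝ)) = (if 0 < V.Δ then 2 else 1 : ℕ)` is a natural number. This is the cell
`pub/bsd-f2-manin` edge F-an-42 ⟹ F-es-21 (HOME/an/Sketch-an-g10.lean ec9872d4893aad5d, `polar_of_real`,
kernel-checked there), so every consumer of the polar fact (line `kato-shift-two` of crux C2 `ManinOddAtFour`,
stmt-BirchSwinnertonDyer-22967) is served by the real-period fact.

## References

* K. Kato, Astérisque 295 (2004): Thm. 6.6 (1) (p. 163), Thm. 9.7 (p. 189). [Kato2004Asterisque]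
-/

noncomputable section

open scoped MatrixGroups ModularForm Classical

open CongruenceSubgroup Literature.NumberTheory.EllipticCurves.ModularForms

namespace Literature.NumberTheory.EllipticCurves

/-- **Real-period reading ⟹ polar reading at `2`.** If `s·ϖ·r` is an algebraic integer for some odd `s`, then so
is `s·#π₀(V(ℝ))·ϖ·r`, `#π₀(V(ℝ)) = (if 0 < V.Δ then 2 else 1 : ℕ)` being a natural number: the named fact
`kato_neron_isIntegral_twistedSymbolSum_of_additive_two_real` implies
`kato_neron_isIntegral_twistedSymbolSum_of_additive_two_polar` (same binders).
[cite: Kato2004Asterisque, Thm. 6.6 (1) (p. 163), Thm. 9.7 (p. 189) (shape of both readings; the implication itself is elementary)] -/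
theorem kato_neron_isIntegral_twistedSymbolSum_of_additive_two_polar_of_real
    (h : kato_neron_isIntegral_twistedSymbolSum_of_additive_two_real) :
    kato_neron_isIntegral_twistedSymbolSum_of_additive_two_polar := by
  intro V _ _ N _ f hf hg hm hirr m _ hcop χ hprim hχ1 hord h8 ϖ r hϖ hval
  obtain ⟨s, hs, hint⟩ := h V f hf hg hm hirr m hcop χ hprim hχ1 hord h8 ϖ r hϖ hval
  refine ⟨s, hs, ?_⟩
  have hn : IsIntegral ℤ (((if 0 < V.Δ then 2 else 1 : ℕ) : ℂ)) := by
    have := isIntegral_algebraMap (R := ℤ) (A := ℂ) (x := ((if 0 < V.Δ then 2 else 1 : ℕ) : ℤ))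
    simpa using this
  have key : ((s : ℂ) * ((if 0 < V.Δ then 2 else 1 : ℕ) : ℂ) * ϖ * r) =
      (((if 0 < V.Δ then 2 else 1 : ℕ) : ℂ)) * ((s : ℂ) * ϖ * r) := by ring
  rw [key]
  exact hn.mul hint

end Literature.NumberTheory.EllipticCurves

end
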